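import Mathlib

/-!
# EriceRemainderEnclosureHistoryAutonomyComparisonAgeCompositionDecaySlotCertificate — (E85a) route (N), first order: THE SCALAR CERTIFICATES
# FOR THE DEEP SLOTS of the (S-d) budget — the young chain of a slot (credit `3d_{p+1}ρ¹_p` against the debit `d_{p−1}` and a surplus of `4∕3·d_{p+1}`
# handed to the boundary) and the old chain (credit `3c_{p+1}ρ_p` against `c_{p−1}`, the lag-zero part and the defect∕tail parts bounded by the DEEP STEP
# `y_{p+k}` — no window-mass∕rise ratio needed), as explicit inequalities between a handful of level ratios, proved by interval splitting on the inner rise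

Cell `pub-balaban`, β-function sub-cell, BINDER row D4 «RemainderConst leaves for Bałaban's split» (`HOME/BINDER-OWNERS.md`; owner lineage `b2b-balaban-beta-an4`;
this file by co-owner #2 lineage `b2b-balaban-beta-d4-p2`, generation 76), β-FLOW TEAM duty (1), FREEZE (0) honoured (def-free; imports `Mathlib` only: pure
real-variable inequalities, no flow object; the flow wrappers that instantiate them are the next files of this station).  Successor item (E84d-2) of README
`HOME/b2b-balaban-beta-d4-p2/g75/e84/README.md` §3∕§5∕§6, with a CHANGED bookkeeping (README `g76/e85/README.md`): the defect part `ϑ_pω_p` of the slot of the pin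
`p` is bounded through the DEEP step (`ϑ_p ≤ (3∕2)y_{p+k} + F_{p+k+1}`, `y_{p+k} = E_p∕(1+E_p)`, `F_{p+k+1} ≤ E_p∕2`, `E_p = (h_{p+k}∕h_{p+k+1})² − 1`) and charged
ENTIRELY to the old chain, so the young chain carries no window-mass factor at all and the two chains DECOUPLE: slot `p ≥ m+3` ⟸ `c_{p+1}·SO + d_{p+1}·SY ≥ 0`
with `SY` (§2) and `SO` (§3, `k ≥ 3`; §4, `k = 2` with the quadratic credit) separately non-negative.

HONEST FRAMING (page 1, verbatim and binding).  *"Discharging BetaPertH makes Bałaban's UV stability UNCONDITIONAL — a real constructive-QFT result; it is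
NOT the continuum limit and NOT the Clay problem."*  THIS FILE DISCHARGES NOTHING OF THE KIND.  Elementary real algebra: every statement below is an
inequality between real numbers under displayed polynomial∕rational hypotheses; the letters are the census letters of route (N) (levels `a = 1∕h²`, level
ratios `t = h_{p+k}∕h_{p+k+1}`, `l = h_{p+k−1}∕h_{p+k}`, `R = (h_{p+1}∕h_{p+k})²`, `w = h_{p+1}∕h_{p+2}`, `v = h_p∕h_{p+1}`, window mass `x = k·L_kh_{p+k}³∕2`, window rise
`σ = 1 − (h_{p+k}∕h_p)²`), but nothing here depends on a flow.  The form, signs, ages and moments of Bałaban's (1.22) limit functional are NOT PRINTED ([I]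
p. 298; GAPS G-t4-U2-1∕-2) and NOT asserted.  Row D4 class UNCHANGED (critical-path width 0; instance 0∕1; D4 DISCHARGE NO DATE).  HONEST DEPENDENCY:
continuum YM on T⁴ ⇐ BetaPertH ∧ nine spine estimates (0/9 proved); BetaPertH ⇐ (D1) ∧ (D4) ∧ CAP+tail; G-an2-4 gates asym, D1 and NE2/3/4.

THE POINT (census sense (α); route (N)).  In units of the two coefficients read by the slot's credit step (`c₁ = c_{p+1} = L_kh_{p+k+1}³∕2`,
`d₁ = d_{p+1} = L_1h_{p+2}³∕2`; `x = k·t³·c₁`), the slot inequality of (E84c) `budget_of_slots` at a pin `p ≥ m+3` with surplus `S_p = (4∕3)d_{p+1}`,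
`F_{p−1} + c_p∕(1−c_p) + ϑ_pω_p + (4∕3)d_{p+1} ≤ (3∕2)y_p`, FOLLOWS from `c₁·SO + d₁·SY ≥ 0` where
**`SY = 3w² − (vw)³ − 4∕3`** (§2 `young_slot_cert`: `≥ 0` whenever `v² ≤ 4∕3`, i.e. `y_p ≤ 1∕4`, and `w² ≤ 1 + y_p`) and
**`SO = 3Rt² − l³t³ − t³∕(1 − x∕k) − k(t²−1)(3t+t³)∕(2(1−x))`** (§3 `old_slot_cert`, `k ≥ 3`: `≥ 0` under the flow relations `t ≤ l`, `l² ≤ 5∕4`, `l² ≤ R`,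
`(k−1)(l²−1) ≤ σ`, `k(t²−1) ≤ σ`, `σ ≤ 1 − 3∕(4R)`, the window-mass cap `4x ≤ 3σ` and the inner-rise relation `2x(1−1∕k)Rq ≤ R − 1`, `q²(1+σ) ≥ 1`).  METHOD: the
debits are monotone in `x`, so `x` sits at the smaller of its two caps; the defect coefficient `k(t²−1) ≤ σ`; what is left is `t·q(t)` with `q` a CONCAVE QUADRATIC
in `t` (§1 `concave_quad_of_ends`: non-negative on `[1,T]` once non-negative at both ends), whose coefficients are monotone in the inner rise `R` — so ten
intervals of `R` with rational corner constants (§3 `old_slot_case`, checked by `norm_num`) cover `R ∈ [1, ∞)`; the generic kernel §1 `old_core` serves the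
boundary file too.  For `k = 2` (§4 `old_slot_two_cert`) the first-order margin is thin and the quadratic credit `3c₁²ρ²` of `(3∕4)y_p²` is kept: the two
convex debits are put under their chords on `[0, X]`, the expression becomes affine in `x` and concave-quadratic in `t`, and three intervals of `R = l²` suffice.
NUMERICS OF RECORD (`g76/numerics/chains.py`, `prooff.py`, `corners2.py`): minima `SY ≥ 0.12`, `SO ≥ 0.28` (`k ≥ 3`), `≥ 0.42` (`k = 2`), attained near zero load;
every corner constant below was generated and verified in exact rational arithmetic (`gen_so.py`).  NOT CLAIMED: anything along a flow (next files); anything printed.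

WHAT IS PROVED ([folklore]; 0 `def`, 0 sorry).  §1 `concave_quad_of_ends`, **`old_core`**; §2 **`young_slot_cert`**; §3 `cap_of_inner`, `old_slot_case`,
**`old_slot_cert`**; §4 `old_slot_two_core`, `old_slot_two_case`, **`old_slot_two_cert`**.
-/
noncomputable section

namespace Summit.QuantumFields.BalabanUV.Beta.EriceRemainderEnclosureHistoryAutonomyComparisonAgeCompositionDecaySlotCertificate

/-! ## §1 Two generic kernels -/

/-- A concave quadratic `B·t − A·t² − C` (`A ≥ 0`) that is non-negative at the two ends of `[1, T]` is non-negative on `[1, T]`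
(Lagrange interpolation: `(T−1)q(t) = (T−t)q(1) + (t−1)q(T) + A(t−1)(T−t)(T−1)`). [folklore] -/
theorem concave_quad_of_ends {A B C t T : ℝ} (hA : 0 ≤ A) (ht1 : 1 ≤ t) (htT : t ≤ T)
    (h1 : 0 ≤ B - A - C) (hT : 0 ≤ B * T - A * T ^ 2 - C) : 0 ≤ B * t - A * t ^ 2 - C := by
  rcases eq_or_lt_of_le (le_trans ht1 htT) with hT1 | hT1
  · have : t = 1 := le_antisymm (hT1 ▸ htT) ht1
    subst this; simpa using h1
  · have key : (T - 1) * (B * t - A * t ^ 2 - C) =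
        (T - t) * (B - A - C) + (t - 1) * (B * T - A * T ^ 2 - C) + A * (t - 1) * (T - t) * (T - 1) := by ring
    have hpos : 0 ≤ (T - 1) * (B * t - A * t ^ 2 - C) := by
      rw [key]
      have := mul_nonneg (sub_nonneg.2 htT) h1
      have := mul_nonneg (sub_nonneg.2 ht1) hT
      have := mul_nonneg (mul_nonneg (mul_nonneg hA (sub_nonneg.2 ht1)) (sub_nonneg.2 htT)) (sub_nonneg.2 hT1.le)
      linarith
    exact nonneg_of_mul_nonneg_right (by rwa [mul_comm] at hpos) (by linarith)

/-- **THE GENERIC OLD-CHAIN KERNEL.**  For reals with `0 < κ ≤ k`, `Rlo ≤ R`, `1 ≤ t ≤ T`, `0 ≤ l`, `l³ ≤ L`, `0 ≤ x ≤ X < min(κ, 1)`, `k(t²−1) ≤ σ ≤ S`,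
an extra credit coefficient `Acr ≥ acr` and a debit coefficient `Dc ≥ 0`: IF the concave quadratic
`q(t) = (3Rlo + acr)t − (L + 1∕(1−X∕κ) + S∕(2(1−X)) + Dc)t² − (3∕2)S∕(1−X)` is non-negative at `t = 1` and `t = T`, THEN
`3Rt² + Acr·t² − l³t³ − t³∕(1 − x∕k) − k(t²−1)(3t+t³)∕(2(1−x)) − Dc·t³ ≥ 0` — every debit is monotone in `x`, the defect coefficient `k(t²−1) ≤ σ ≤ S`,
and the remainder is `t·q(t)`. [folklore] -/
theorem old_core {R t l x k σ Acr Rlo acr X T L S κ Dc : ℝ}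
    (hκ : 0 < κ) (hkκ : κ ≤ k) (hR : Rlo ≤ R) (ht1 : 1 ≤ t) (htT : t ≤ T) (hl0 : 0 ≤ l) (hlL : l ^ 3 ≤ L)
    (hx0 : 0 ≤ x) (hxX : x ≤ X) (hXκ : X < κ) (hX1 : X < 1) (hkt : k * (t ^ 2 - 1) ≤ σ) (hσS : σ ≤ S)
    (hacr : acr ≤ Acr) (hDc : 0 ≤ Dc)
    (h1 : 0 ≤ (3 * Rlo + acr) - (L + 1 / (1 - X / κ) + S / (2 * (1 - X)) + Dc) - 3 / 2 * S / (1 - X))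
    (hT : 0 ≤ (3 * Rlo + acr) * T - (L + 1 / (1 - X / κ) + S / (2 * (1 - X)) + Dc) * T ^ 2 - 3 / 2 * S / (1 - X)) :
    0 ≤ 3 * R * t ^ 2 + Acr * t ^ 2 - l ^ 3 * t ^ 3 - t ^ 3 / (1 - x / k)
      - k * (t ^ 2 - 1) * (3 * t + t ^ 3) / (2 * (1 - x)) - Dc * t ^ 3 := by
  have hk0 : 0 < k := lt_of_lt_of_le hκ hkκ
  have hxk : x / k ≤ X / κ :=
    calc x / k ≤ x / κ := div_le_div_of_nonneg_left hx0 hκ hkκ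
      _ ≤ X / κ := div_le_div_of_nonneg_right hxX hκ.le
  have hden1 : 0 < 1 - X / κ := by rw [sub_pos, div_lt_one hκ]; exact hXκ
  have hden1' : 0 < 1 - x / k := by linarith
  have hinv1 : 1 / (1 - x / k) ≤ 1 / (1 - X / κ) := one_div_le_one_div_of_le hden1 (by linarith)
  have hden2 : 0 < 1 - X := by linarith
  have hden2' : 0 < 1 - x := by linarith
  have hinv2 : 1 / (1 - x) ≤ 1 / (1 - X) := one_div_le_one_div_of_le hden2 (by linarith)
  have ht0 : 0 ≤ t := by linarith
  have ht3 : 0 ≤ t ^ 3 := by positivity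
  have hσ0 : 0 ≤ σ := le_trans (mul_nonneg hk0.le (by nlinarith)) hkt
  have hS0 : 0 ≤ S := hσ0.trans hσS
  have hL0 : 0 ≤ L := le_trans (by positivity) hlL
  have d1 : t ^ 3 / (1 - x / k) ≤ t ^ 3 * (1 / (1 - X / κ)) := by
    rw [div_eq_mul_one_div]; exact mul_le_mul_of_nonneg_left hinv1 ht3
  have hpos : 0 ≤ 3 * t + t ^ 3 := by positivity
  have d2 : k * (t ^ 2 - 1) * (3 * t + t ^ 3) / (2 * (1 - x)) ≤ S * (3 * t + t ^ 3) / 2 * (1 / (1 - X)) := by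
    have e : k * (t ^ 2 - 1) * (3 * t + t ^ 3) / (2 * (1 - x)) = k * (t ^ 2 - 1) * (3 * t + t ^ 3) / 2 * (1 / (1 - x)) := by
      field_simp
    rw [e]
    have hnum : k * (t ^ 2 - 1) * (3 * t + t ^ 3) / 2 ≤ S * (3 * t + t ^ 3) / 2 := by
      have := mul_le_mul_of_nonneg_right (hkt.trans hσS) hpos; linarith
    have hnum0 : 0 ≤ k * (t ^ 2 - 1) * (3 * t + t ^ 3) / 2 := by
      have : 0 ≤ k * (t ^ 2 - 1) := mul_nonneg hk0.le (by nlinarith)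
      positivity
    exact mul_le_mul hnum hinv2 (by positivity) (by positivity)
  have d3 : l ^ 3 * t ^ 3 ≤ L * t ^ 3 := mul_le_mul_of_nonneg_right hlL ht3
  have c1 : 3 * Rlo * t ^ 2 ≤ 3 * R * t ^ 2 := by nlinarith
  have c2 : acr * t ^ 2 ≤ Acr * t ^ 2 := mul_le_mul_of_nonneg_right hacr (by positivity)
  have hA : 0 ≤ L + 1 / (1 - X / κ) + S / (2 * (1 - X)) + Dc := by positivity
  have hq := concave_quad_of_ends (B := 3 * Rlo + acr) hA ht1 htT (by linarith) hT
  have e : 3 * Rlo * t ^ 2 + acr * t ^ 2 - L * t ^ 3 - t ^ 3 * (1 / (1 - X / κ)) - S * (3 * t + t ^ 3) / 2 * (1 / (1 - X)) - Dc * t ^ 3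
      = t * ((3 * Rlo + acr) * t - (L + 1 / (1 - X / κ) + S / (2 * (1 - X)) + Dc) * t ^ 2 - 3 / 2 * S / (1 - X)) := by
    field_simp; ring
  have := mul_nonneg ht0 hq
  rw [← e] at this
  linarith

/-! ## §2 The young chain of a deep slot -/

/-- **THE YOUNG CHAIN OF A DEEP SLOT.**  With `v = h_p∕h_{p+1}`, `w = h_{p+1}∕h_{p+2}` (`v² = 1∕(1−y_p) ≤ 4∕3` for a pin of depth `≥ 3`, `w² = 1 + z_{p+1} ≤ 1 + y_p`,
i.e. `v²w² ≤ 2v² − 1`): `(vw)³ + 4∕3 ≤ 3w²` — the young debit `d_{p−1} = (vw)³d_{p+1}` and the surplus `(4∕3)d_{p+1}` against the young credit `3d_{p+1}w²`.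
(Two regimes of `P = vw ∈ [1, √(5∕3)]`: `w² ≥ 1` for `P ≤ 1.18`, `w² ≥ (3∕4)P²` beyond.) [folklore] -/
theorem young_slot_cert {v w : ℝ} (hv1 : 1 ≤ v) (hv : v ^ 2 ≤ 4 / 3) (hw1 : 1 ≤ w) (hvw : v ^ 2 * w ^ 2 ≤ 2 * v ^ 2 - 1) :
    (v * w) ^ 3 + 4 / 3 ≤ 3 * w ^ 2 := by
  set P := v * w with hP
  have hP1 : 1 ≤ P := by rw [hP]; nlinarith
  have hP2 : P ^ 2 ≤ 5 / 3 := by rw [hP, mul_pow]; nlinarith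
  have hw2 : 3 * P ^ 2 ≤ 4 * w ^ 2 := by
    rw [hP, mul_pow]; nlinarith [sq_nonneg w, mul_le_mul_of_nonneg_right hv (sq_nonneg w)]
  have hw1' : 1 ≤ w ^ 2 := by nlinarith
  rcases le_or_gt P (118 / 100) with hPs | hPb
  · have : P ^ 3 ≤ (118 / 100) ^ 3 := pow_le_pow_left₀ (by linarith) hPs 3
    nlinarith
  · have hPhi : P ≤ 13 / 10 := by nlinarith
    nlinarith [mul_nonneg (mul_nonneg (sub_nonneg.2 hPb.le) (sub_nonneg.2 hPhi)) (by linarith : (0:ℝ) ≤ P)]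

/-! ## §3 The old chain of a deep slot, `k ≥ 3` -/

/-- The window-mass cap from the inner-rise relation: `2x(1−1∕k)Rq ≤ R − 1` with `q ≥ 1∕√(1+σ) ≥ 1∕sh` (`sh² ≥ 1 + S ≥ 1 + σ`), `k ≥ 3` and `R ≤ Rhi` give
`x ≤ (3∕4)·sh·(1 − 1∕Rhi)`. [folklore] -/
theorem cap_of_inner {x k R q σ S sh Rhi : ℝ} (hk : 3 ≤ k) (hR1 : 1 ≤ R) (hRhi : R ≤ Rhi) (hx0 : 0 ≤ x) (hq0 : 0 < q)
    (hq : 1 ≤ q ^ 2 * (1 + σ)) (hσS : σ ≤ S) (hsh0 : 0 < sh) (hsh : 1 + S ≤ sh ^ 2)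
    (hCin : 2 * x * (1 - 1 / k) * R * q ≤ R - 1) : x ≤ 3 / 4 * sh * (1 - 1 / Rhi) := by
  have hk0 : 0 < k := by linarith
  have hqs : 1 ≤ q * sh := by
    have h2 : 1 ≤ (q * sh) ^ 2 := by
      rw [mul_pow]
      calc (1:ℝ) ≤ q ^ 2 * (1 + σ) := hq
        _ ≤ q ^ 2 * sh ^ 2 := mul_le_mul_of_nonneg_left (by linarith) (sq_nonneg q)
    nlinarith [mul_pos hq0 hsh0]
  have hk' : 2 / 3 ≤ 1 - 1 / k := by
    have : 1 / k ≤ 1 / 3 := one_div_le_one_div_of_le (by norm_num) hk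
    linarith
  have hRpos : 0 < R := by linarith
  have h3 : 2 * x * (2 / 3) * R * q ≤ R - 1 := by
    have : 2 * x * (2 / 3) * R * q ≤ 2 * x * (1 - 1 / k) * R * q := by
      have := mul_le_mul_of_nonneg_left hk' (by positivity : 0 ≤ 2 * x * R * q); nlinarith
    linarith
  have h4 : 4 / 3 * x * R ≤ (R - 1) * sh := by
    have h5 := mul_le_mul_of_nonneg_right h3 hsh0.le
    have h6 : 0 ≤ x * R * (q * sh - 1) := mul_nonneg (mul_nonneg hx0 hRpos.le) (sub_nonneg.2 hqs)
    nlinarith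
  have h5 : x ≤ 3 / 4 * sh * (1 - 1 / R) := by
    rw [show 3 / 4 * sh * (1 - 1 / R) = 3 / 4 * sh * (R - 1) / R by field_simp]
    rw [le_div_iff₀ hRpos]; linarith
  have h6 : 1 - 1 / R ≤ 1 - 1 / Rhi := by
    have : 1 / Rhi ≤ 1 / R := one_div_le_one_div_of_le hRpos hRhi; linarith
  exact h5.trans (mul_le_mul_of_nonneg_left h6 (by positivity))

/-- One interval of the inner rise: the old-chain certificate for `k ≥ 3` on `R ∈ [Rlo, Rhi]` from rational corner constants `S, sh, X, T2, T, l2m, lh, L`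
satisfying the displayed elementary conditions and the two corner inequalities of §1 `old_core` (`κ = 3`, no extra credit, no extra debit). [folklore] -/
theorem old_slot_case {R t l x k σ q Rlo Rhi S sh X T2 T l2m lh L : ℝ}
    (hk : 3 ≤ k) (hR1 : 1 ≤ R) (ht1 : 1 ≤ t) (hl1 : 1 ≤ l) (htl : t ≤ l) (hly : l ^ 2 ≤ 5 / 4) (hlR : l ^ 2 ≤ R)
    (hlσ : (k - 1) * (l ^ 2 - 1) ≤ σ) (hkt : k * (t ^ 2 - 1) ≤ σ) (hσR : σ ≤ 1 - 3 / (4 * R)) (hx0 : 0 ≤ x) (hxa : 4 * x ≤ 3 * σ)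
    (hq0 : 0 < q) (hq : 1 ≤ q ^ 2 * (1 + σ)) (hCin : 2 * x * (1 - 1 / k) * R * q ≤ R - 1)
    (hRlo : Rlo ≤ R) (hRhi : R ≤ Rhi) (hS : 1 - 3 / (4 * Rhi) ≤ S) (hsh0 : 0 < sh) (hsh : 1 + S ≤ sh ^ 2)
    (hX : 3 / 4 * S ≤ X ∨ 3 / 4 * sh * (1 - 1 / Rhi) ≤ X) (hX1 : X < 1)
    (hT2 : 1 + S / 3 ≤ T2 ∨ Rhi ≤ T2 ∨ 5 / 4 ≤ T2) (hT0 : 0 ≤ T) (hT : T2 ≤ T ^ 2)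
    (hl2m : 5 / 4 ≤ l2m ∨ Rhi ≤ l2m ∨ 1 + S / 2 ≤ l2m) (hlh0 : 0 ≤ lh) (hlh : l2m ≤ lh ^ 2) (hL : lh * l2m ≤ L)
    (h1 : 0 ≤ 3 * Rlo - (L + 1 / (1 - X / 3) + S / (2 * (1 - X))) - 3 / 2 * S / (1 - X))
    (hT' : 0 ≤ 3 * Rlo * T - (L + 1 / (1 - X / 3) + S / (2 * (1 - X))) * T ^ 2 - 3 / 2 * S / (1 - X)) :
    0 ≤ 3 * R * t ^ 2 - l ^ 3 * t ^ 3 - t ^ 3 / (1 - x / k) - k * (t ^ 2 - 1) * (3 * t + t ^ 3) / (2 * (1 - x)) := by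
  have hRpos : 0 < R := by linarith
  have hRhi0 : 0 < Rhi := by linarith
  have hσS : σ ≤ S := by
    have : 3 / (4 * Rhi) ≤ 3 / (4 * R) := div_le_div_of_nonneg_left (by norm_num) (by positivity) (by linarith)
    linarith
  have ht0 : 0 ≤ t := by linarith
  have hl0 : 0 ≤ l := by linarith
  have htl2 : t ^ 2 ≤ l ^ 2 := pow_le_pow_left₀ ht0 htl 2
  have hE1a : t ^ 2 ≤ 1 + S / 3 := by
    have h0 : 0 ≤ t ^ 2 - 1 := by nlinarith
    have : 3 * (t ^ 2 - 1) ≤ k * (t ^ 2 - 1) := mul_le_mul_of_nonneg_right hk h0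
    linarith
  have hE1b : t ^ 2 ≤ Rhi := by linarith
  have hE1c : t ^ 2 ≤ 5 / 4 := htl2.trans hly
  have htT2 : t ^ 2 ≤ T2 := by rcases hT2 with h | h | h <;> linarith
  have htT : t ≤ T := (pow_le_pow_iff_left₀ ht0 hT0 two_ne_zero).mp (htT2.trans hT)
  have hE2c : l ^ 2 ≤ 1 + S / 2 := by
    have h0 : 0 ≤ l ^ 2 - 1 := by nlinarith
    have : 2 * (l ^ 2 - 1) ≤ (k - 1) * (l ^ 2 - 1) := mul_le_mul_of_nonneg_right (by linarith) h0
    linarith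
  have hl2 : l ^ 2 ≤ l2m := by rcases hl2m with h | h | h <;> linarith
  have hllh : l ≤ lh := (pow_le_pow_iff_left₀ hl0 hlh0 two_ne_zero).mp (hl2.trans hlh)
  have hlL : l ^ 3 ≤ L :=
    calc l ^ 3 = l * l ^ 2 := by ring
      _ ≤ lh * l2m := mul_le_mul hllh hl2 (by positivity) hlh0
      _ ≤ L := hL
  have hxX : x ≤ X := by
    rcases hX with h | h
    · linarith
    · exact le_trans (cap_of_inner hk hR1 hRhi hx0 hq0 hq hσS hsh0 hsh hCin) h
  have := old_core (κ := 3) (Acr := 0) (acr := 0) (Dc := 0) (by norm_num) hk hRlo ht1 htT hl0 hlL hx0 hxX (by linarith) hX1 hkt hσS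
    le_rfl le_rfl (by linarith [h1]) (by linarith [hT'])
  linarith [this]

/-- **THE OLD CHAIN OF A DEEP SLOT, `k ≥ 3`.**  In the census letters of the slot of a pin `p ≥ m+3` of a two-age flow `{1, k}` (`t = h_{p+k}∕h_{p+k+1}`,
`l = h_{p+k−1}∕h_{p+k}`, `R = (h_{p+1}∕h_{p+k})²`, `x = k·L_kh_{p+k}³∕2`, `σ = 1 − (h_{p+k}∕h_p)²`, `q = h_{p+2k}∕h_{p+k}`), under the flow relations
`t ≤ l` (increments decrease), `l² ≤ 5∕4`, `l² ≤ R`, `(k−1)(l²−1) ≤ σ`, `k(t²−1) ≤ σ` (a step is at most the rise above it over its length), `σ ≤ 1 − 3∕(4R)`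
(`y_p ≤ 1∕4`), `4x ≤ 3σ` (the window-mass cap), `q²(1+σ) ≥ 1` (the reads below the window within the tangent factor) and `2x(1−1∕k)Rq ≤ R−1` (the inner rise
dominates the old reads inside it):  `3Rt² − l³t³ − t³∕(1−x∕k) − k(t²−1)(3t+t³)∕(2(1−x)) ≥ 0` — per unit `c_{p+1}`: the old credit `3c_{p+1}ρ_p` pays
`c_{p−1} = (lt)³c_{p+1}`, the lag-zero part `c_p∕(1−c_p)` (`c_p = t³c_{p+1} = x∕k`) and the defect∕tail parts `ϑ_pω_p ≤ (t²−1)(3∕(2t²) + 1∕2)·x∕(1−x)`.  Ten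
intervals of `R` (§3 `old_slot_case`). [folklore] -/
theorem old_slot_cert {R t l x k σ q : ℝ}
    (hk : 3 ≤ k) (hR1 : 1 ≤ R) (ht1 : 1 ≤ t) (hl1 : 1 ≤ l) (htl : t ≤ l) (hly : l ^ 2 ≤ 5 / 4) (hlR : l ^ 2 ≤ R)
    (hlσ : (k - 1) * (l ^ 2 - 1) ≤ σ) (hkt : k * (t ^ 2 - 1) ≤ σ) (hσR : σ ≤ 1 - 3 / (4 * R)) (hx0 : 0 ≤ x) (hxa : 4 * x ≤ 3 * σ)
    (hq0 : 0 < q) (hq : 1 ≤ q ^ 2 * (1 + σ)) (hCin : 2 * x * (1 - 1 / k) * R * q ≤ R - 1) :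
    0 ≤ 3 * R * t ^ 2 - l ^ 3 * t ^ 3 - t ^ 3 / (1 - x / k) - k * (t ^ 2 - 1) * (3 * t + t ^ 3) / (2 * (1 - x)) := by
  by_cases hc0 : R ≤ 221 / 200
  · exact old_slot_case hk hR1 ht1 hl1 htl hly hlR hlσ hkt hσR hx0 hxa hq0 hq hCin hR1 hc0 (S := 71 / 221) (sh := 23 / 20) (X := 1449 / 17680) (T2 := 221 / 200) (T := 263 / 250) (l2m := 221 / 200) (lh := 263 / 250) (L := 1163 / 1000) (by norm_num) (by norm_num) (by norm_num) (Or.inr (by norm_num)) (by norm_num) (Or.inr (Or.inl (by norm_num))) (by norm_num) (by norm_num) (Or.inr (Or.inl (by norm_num))) (by norm_num) (by norm_num) (by norm_num) (by norm_num) (by norm_num)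
  by_cases hc1 : R ≤ 237 / 200
  · exact old_slot_case hk hR1 ht1 hl1 htl hly hlR hlσ hkt hσR hx0 hxa hq0 hq hCin (not_le.mp hc0).le hc1 (S := 29 / 79) (sh := 117 / 100) (X := 4329 / 31600) (T2 := 266 / 237) (T := 53 / 50) (l2m := 187 / 158) (lh := 136 / 125) (L := 161 / 125) (by norm_num) (by norm_num) (by norm_num) (Or.inr (by norm_num)) (by norm_num) (Or.inl (by norm_num)) (by norm_num) (by norm_num) (Or.inr (Or.inr (by norm_num))) (by norm_num) (by norm_num) (by norm_num) (by norm_num) (by norm_num)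
  by_cases hc2 : R ≤ 319 / 250
  · exact old_slot_case hk hR1 ht1 hl1 htl hly hlR hlσ hkt hσR hx0 hxa hq0 hq hCin (not_le.mp hc1).le hc2 (S := 263 / 638) (sh := 1189 / 1000) (X := 8487 / 44000) (T2 := 2177 / 1914) (T := 1067 / 1000) (l2m := 1539 / 1276) (lh := 1099 / 1000) (L := 663 / 500) (by norm_num) (by norm_num) (by norm_num) (Or.inr (by norm_num)) (by norm_num) (Or.inl (by norm_num)) (by norm_num) (by norm_num) (Or.inr (Or.inr (by norm_num))) (by norm_num) (by norm_num) (by norm_num) (by norm_num) (by norm_num)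
  by_cases hc3 : R ≤ 1383 / 1000
  · exact old_slot_case hk hR1 ht1 hl1 htl hly hlR hlσ hkt hσR hx0 hxa hq0 hq hCin (not_le.mp hc2).le hc3 (S := 211 / 461) (sh := 151 / 125) (X := 57833 / 230500) (T2 := 1594 / 1383) (T := 537 / 500) (l2m := 1133 / 922) (lh := 1109 / 1000) (L := 1363 / 1000) (by norm_num) (by norm_num) (by norm_num) (Or.inr (by norm_num)) (by norm_num) (Or.inl (by norm_num)) (by norm_num) (by norm_num) (Or.inr (Or.inr (by norm_num))) (by norm_num) (by norm_num) (by norm_num) (by norm_num) (by norm_num)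
  by_cases hc4 : R ≤ 1517 / 1000
  · exact old_slot_case hk hR1 ht1 hl1 htl hly hlR hlσ hkt hσR hx0 hxa hq0 hq hCin (not_le.mp hc3).le hc4 (S := 767 / 1517) (sh := 307 / 250) (X := 476157 / 1517000) (T2 := 5318 / 4551) (T := 1081 / 1000) (l2m := 5 / 4) (lh := 1119 / 1000) (L := 1399 / 1000) (by norm_num) (by norm_num) (by norm_num) (Or.inr (by norm_num)) (by norm_num) (Or.inl (by norm_num)) (by norm_num) (by norm_num) (Or.inl (by norm_num)) (by norm_num) (by norm_num) (by norm_num) (by norm_num) (by norm_num)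
  by_cases hc5 : R ≤ 1709 / 1000
  · exact old_slot_case hk hR1 ht1 hl1 htl hly hlR hlσ hkt hσR hx0 hxa hq0 hq hCin (not_le.mp hc4).le hc5 (S := 959 / 1709) (sh := 5 / 4) (X := 10635 / 27344) (T2 := 6086 / 5127) (T := 109 / 100) (l2m := 5 / 4) (lh := 1119 / 1000) (L := 1399 / 1000) (by norm_num) (by norm_num) (by norm_num) (Or.inr (by norm_num)) (by norm_num) (Or.inl (by norm_num)) (by norm_num) (by norm_num) (Or.inl (by norm_num)) (by norm_num) (by norm_num) (by norm_num) (by norm_num) (by norm_num)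
  by_cases hc6 : R ≤ 1009 / 500
  · exact old_slot_case hk hR1 ht1 hl1 htl hly hlR hlσ hkt hσR hx0 hxa hq0 hq hCin (not_le.mp hc5).le hc6 (S := 634 / 1009) (sh := 1277 / 1000) (X := 951 / 2018) (T2 := 3661 / 3027) (T := 11 / 10) (l2m := 5 / 4) (lh := 1119 / 1000) (L := 1399 / 1000) (by norm_num) (by norm_num) (by norm_num) (Or.inl (by norm_num)) (by norm_num) (Or.inl (by norm_num)) (by norm_num) (by norm_num) (Or.inl (by norm_num)) (by norm_num) (by norm_num) (by norm_num) (by norm_num) (by norm_num)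
  by_cases hc7 : R ≤ 354 / 125
  · exact old_slot_case hk hR1 ht1 hl1 htl hly hlR hlσ hkt hσR hx0 hxa hq0 hq hCin (not_le.mp hc6).le hc7 (S := 347 / 472) (sh := 659 / 500) (X := 1041 / 1888) (T2 := 1763 / 1416) (T := 279 / 250) (l2m := 5 / 4) (lh := 1119 / 1000) (L := 1399 / 1000) (by norm_num) (by norm_num) (by norm_num) (Or.inl (by norm_num)) (by norm_num) (Or.inl (by norm_num)) (by norm_num) (by norm_num) (Or.inl (by norm_num)) (by norm_num) (by norm_num) (by norm_num) (by norm_num) (by norm_num)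
  by_cases hc8 : R ≤ 6
  · exact old_slot_case hk hR1 ht1 hl1 htl hly hlR hlσ hkt hσR hx0 hxa hq0 hq hCin (not_le.mp hc7).le hc8 (S := 7 / 8) (sh := 137 / 100) (X := 21 / 32) (T2 := 5 / 4) (T := 1119 / 1000) (l2m := 5 / 4) (lh := 1119 / 1000) (L := 1399 / 1000) (by norm_num) (by norm_num) (by norm_num) (Or.inl (by norm_num)) (by norm_num) (Or.inr (Or.inr (by norm_num))) (by norm_num) (by norm_num) (Or.inl (by norm_num)) (by norm_num) (by norm_num) (by norm_num) (by norm_num) (by norm_num)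
  exact old_slot_case hk hR1 ht1 hl1 htl hly hlR hlσ hkt hσR hx0 hxa hq0 hq hCin (not_le.mp hc8).le le_rfl (S := 1) (sh := 283 / 200) (X := 3 / 4) (T2 := 5 / 4) (T := 1119 / 1000) (l2m := 5 / 4) (lh := 1119 / 1000) (L := 1399 / 1000) (by linarith [div_nonneg (by norm_num : (0:ℝ) ≤ 3) (by linarith : (0:ℝ) ≤ 4 * R)]) (by norm_num) (by norm_num) (Or.inl (by norm_num)) (by norm_num) (Or.inr (Or.inr (by norm_num))) (by norm_num) (by norm_num) (Or.inl (by norm_num)) (by norm_num) (by norm_num) (by norm_num) (by norm_num) (by norm_num)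

/-! ## §4 The old chain of a deep slot, `k = 2`, with the quadratic credit -/

/-- The kernel for `k = 2`: with `R = l²`, the credit `3l²t² + (3∕2)x·l⁴·t` (first order plus the old part `3c₁ρ²·c₁` of the quadratic credit `(3∕4)y_p²`,
per unit `c₁`; `x = 2t³c₁`) against `l³t³ + t³∕(1−x∕2) + 2(t²−1)(3t+t³)∕(2(1−x))`.  The two convex debits are put under their chords on `[0, X]`
(`1∕(1−x∕2) ≤ 1 + x∕(2−X)`, `1∕(1−x) ≤ 1 + x∕(1−X)`), the defect coefficient `2(t²−1) ≤ σ ≤ S`; the remainder is `t·g(x,t)` with `g` affine in `x` and concave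
quadratic in `t`, so the four corners `(0,1), (0,T), (X,1), (X,T)` decide. [folklore] -/
theorem old_slot_two_core {l t x σ Rlo X T L S : ℝ}
    (hRlo0 : 0 ≤ Rlo) (hRlo : Rlo ≤ l ^ 2) (ht1 : 1 ≤ t) (htT : t ≤ T) (hl0 : 0 ≤ l) (hlL : l ^ 3 ≤ L)
    (hx0 : 0 ≤ x) (hxX : x ≤ X) (hX0 : 0 < X) (hX1 : X < 1) (h2t : 2 * (t ^ 2 - 1) ≤ σ) (hσS : σ ≤ S)
    (g01 : 0 ≤ 3 * Rlo - (L + 1 + S / 2) - 3 / 2 * S)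
    (g0T : 0 ≤ 3 * Rlo * T - (L + 1 + S / 2) * T ^ 2 - 3 / 2 * S)
    (gX1 : 0 ≤ 3 * Rlo - (L + 1 + X / (2 - X) + S / 2 * (1 + X / (1 - X))) - (3 / 2 * S * (1 + X / (1 - X)) - 3 / 2 * X * Rlo ^ 2))
    (gXT : 0 ≤ 3 * Rlo * T - (L + 1 + X / (2 - X) + S / 2 * (1 + X / (1 - X))) * T ^ 2 - (3 / 2 * S * (1 + X / (1 - X)) - 3 / 2 * X * Rlo ^ 2)) :
    0 ≤ 3 * l ^ 2 * t ^ 2 + 3 / 2 * x * l ^ 4 * t - l ^ 3 * t ^ 3 - t ^ 3 / (1 - x / 2) - 2 * (t ^ 2 - 1) * (3 * t + t ^ 3) / (2 * (1 - x)) := by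
  have ht0 : 0 ≤ t := by linarith
  have ht3 : 0 ≤ t ^ 3 := by positivity
  have hσ0 : 0 ≤ σ := le_trans (by nlinarith) h2t
  have hS0 : 0 ≤ S := hσ0.trans hσS
  have hL0 : 0 ≤ L := le_trans (by positivity) hlL
  have h1X : 0 < 1 - X := by linarith
  have h2X : 0 < 2 - X := by linarith
  have h1x : 0 < 1 - x := by linarith
  have h2x : 0 < 1 - x / 2 := by linarith
  -- the chords of the two convex debits on `[0, X]`
  have ch1 : 1 / (1 - x / 2) ≤ 1 + x / (2 - X) := by
    rw [div_le_iff₀ h2x]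
    have h0 : 0 ≤ x * (X - x) / (2 * (2 - X)) := div_nonneg (mul_nonneg hx0 (by linarith)) (by linarith)
    have e : (1 + x / (2 - X)) * (1 - x / 2) = 1 + x * (X - x) / (2 * (2 - X)) := by field_simp; ring
    rw [e]; linarith
  have ch2 : 1 / (1 - x) ≤ 1 + x / (1 - X) := by
    rw [div_le_iff₀ h1x]
    have h0 : 0 ≤ x * (X - x) / (1 - X) := div_nonneg (mul_nonneg hx0 (by linarith)) h1X.le
    have e : (1 + x / (1 - X)) * (1 - x) = 1 + x * (X - x) / (1 - X) := by field_simp; ring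
    rw [e]; linarith
  have hq1 : 0 ≤ X / (2 - X) := div_nonneg hX0.le h2X.le
  have hq2 : 0 ≤ X / (1 - X) := div_nonneg hX0.le h1X.le
  -- the two end quadratics are non-negative on `[1, T]`
  have hA0 : 0 ≤ L + 1 + S / 2 := by positivity
  have hAX : 0 ≤ L + 1 + X / (2 - X) + S / 2 * (1 + X / (1 - X)) := by
    have := mul_nonneg (by linarith : 0 ≤ S / 2) hq2; nlinarith
  have q0 := concave_quad_of_ends (B := 3 * Rlo) (C := 3 / 2 * S) hA0 ht1 htT (by linarith) g0T
  have qX := concave_quad_of_ends (B := 3 * Rlo) (C := 3 / 2 * S * (1 + X / (1 - X)) - 3 / 2 * X * Rlo ^ 2) hAX ht1 htT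
    (by linarith) gXT
  -- `g(x,t) = q0(t) + x·m(t)` is affine in `x` with `g(X,t) = qX(t)`
  set m := 3 / 2 * Rlo ^ 2 - (1 / (2 - X) + S / 2 * (1 / (1 - X))) * t ^ 2 - 3 / 2 * S * (1 / (1 - X)) with hm
  have eX : 3 * Rlo * t - (L + 1 + X / (2 - X) + S / 2 * (1 + X / (1 - X))) * t ^ 2 - (3 / 2 * S * (1 + X / (1 - X)) - 3 / 2 * X * Rlo ^ 2)
      = (3 * Rlo * t - (L + 1 + S / 2) * t ^ 2 - 3 / 2 * S) + X * m := by rw [hm]; ring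
  have hg : 0 ≤ (3 * Rlo * t - (L + 1 + S / 2) * t ^ 2 - 3 / 2 * S) + x * m := by
    rcases le_or_gt 0 m with hm0 | hm0
    · have := mul_nonneg hx0 hm0; linarith only [this, q0]
    · have : X * m ≤ x * m := by
        have := mul_le_mul_of_nonpos_right hxX hm0.le
        linarith only [this]
      linarith only [this, qX, eX]
  -- the actual expression is at least `t·g(x,t)`
  have hl4 : Rlo ^ 2 ≤ l ^ 4 :=
    calc Rlo ^ 2 ≤ (l ^ 2) ^ 2 := pow_le_pow_left₀ hRlo0 hRlo 2
      _ = l ^ 4 := by ring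
  have c1 : 3 * Rlo * t ^ 2 ≤ 3 * l ^ 2 * t ^ 2 :=
    mul_le_mul_of_nonneg_right (by linarith only [hRlo]) (sq_nonneg t)
  have c2 : 3 / 2 * x * Rlo ^ 2 * t ≤ 3 / 2 * x * l ^ 4 * t := by
    have h32 : 0 ≤ 3 / 2 * x := by positivity
    have := mul_le_mul_of_nonneg_left hl4 h32
    exact mul_le_mul_of_nonneg_right (by linarith only [this]) ht0
  have d1 : t ^ 3 / (1 - x / 2) ≤ t ^ 3 * (1 + x / (2 - X)) := by
    rw [div_eq_mul_one_div]; exact mul_le_mul_of_nonneg_left ch1 ht3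
  have hpos : 0 ≤ 3 * t + t ^ 3 := by positivity
  have d2 : 2 * (t ^ 2 - 1) * (3 * t + t ^ 3) / (2 * (1 - x)) ≤ S * (3 * t + t ^ 3) / 2 * (1 + x / (1 - X)) := by
    have e2 : 2 * (t ^ 2 - 1) * (3 * t + t ^ 3) / (2 * (1 - x)) = 2 * (t ^ 2 - 1) * (3 * t + t ^ 3) / 2 * (1 / (1 - x)) := by
      rw [mul_one_div, div_div]
    rw [e2]
    have ht21 : 0 ≤ t ^ 2 - 1 := by nlinarith only [ht1]
    have hnum : 2 * (t ^ 2 - 1) * (3 * t + t ^ 3) / 2 ≤ S * (3 * t + t ^ 3) / 2 := by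
      have := mul_le_mul_of_nonneg_right (h2t.trans hσS) hpos; linarith only [this]
    have hnum0 : 0 ≤ 2 * (t ^ 2 - 1) * (3 * t + t ^ 3) / 2 := by positivity
    have hS2 : 0 ≤ S * (3 * t + t ^ 3) / 2 := by positivity
    exact mul_le_mul hnum ch2 (by positivity) hS2
  have d3 : l ^ 3 * t ^ 3 ≤ L * t ^ 3 := mul_le_mul_of_nonneg_right hlL ht3
  have e : 3 * Rlo * t ^ 2 + 3 / 2 * x * Rlo ^ 2 * t - L * t ^ 3 - t ^ 3 * (1 + x / (2 - X)) - S * (3 * t + t ^ 3) / 2 * (1 + x / (1 - X))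
      = t * ((3 * Rlo * t - (L + 1 + S / 2) * t ^ 2 - 3 / 2 * S) + x * m) := by rw [hm]; ring
  have hfin := mul_nonneg ht0 hg
  rw [← e] at hfin
  linarith only [hfin, c1, c2, d1, d2, d3]

/-- One interval of `R = l²` for the `k = 2` old chain, from rational corner constants. [folklore] -/
theorem old_slot_two_case {l t x σ Rlo Rhi S X T2 T lh L : ℝ}
    (ht1 : 1 ≤ t) (hl1 : 1 ≤ l) (htl : t ≤ l) (hly : l ^ 2 ≤ 5 / 4) (h2t : 2 * (t ^ 2 - 1) ≤ σ) (hσR : σ ≤ 1 - 3 / (4 * l ^ 2))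
    (hx0 : 0 ≤ x) (hxa : 4 * x ≤ 3 * σ)
    (hRlo0 : 0 ≤ Rlo) (hRlo : Rlo ≤ l ^ 2) (hRhi : l ^ 2 ≤ Rhi) (hS : 1 - 3 / (4 * Rhi) ≤ S) (hX : 3 / 4 * S ≤ X) (hX0 : 0 < X) (hX1 : X < 1)
    (hT2 : 1 + S / 2 ≤ T2 ∨ Rhi ≤ T2 ∨ 5 / 4 ≤ T2) (hT0 : 0 ≤ T) (hT : T2 ≤ T ^ 2) (hlh0 : 0 ≤ lh) (hlh : Rhi ≤ lh ^ 2) (hL : lh * Rhi ≤ L)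
    (g01 : 0 ≤ 3 * Rlo - (L + 1 + S / 2) - 3 / 2 * S)
    (g0T : 0 ≤ 3 * Rlo * T - (L + 1 + S / 2) * T ^ 2 - 3 / 2 * S)
    (gX1 : 0 ≤ 3 * Rlo - (L + 1 + X / (2 - X) + S / 2 * (1 + X / (1 - X))) - (3 / 2 * S * (1 + X / (1 - X)) - 3 / 2 * X * Rlo ^ 2))
    (gXT : 0 ≤ 3 * Rlo * T - (L + 1 + X / (2 - X) + S / 2 * (1 + X / (1 - X))) * T ^ 2 - (3 / 2 * S * (1 + X / (1 - X)) - 3 / 2 * X * Rlo ^ 2)) :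
    0 ≤ 3 * l ^ 2 * t ^ 2 + 3 / 2 * x * l ^ 4 * t - l ^ 3 * t ^ 3 - t ^ 3 / (1 - x / 2) - 2 * (t ^ 2 - 1) * (3 * t + t ^ 3) / (2 * (1 - x)) := by
  have hl0 : 0 ≤ l := by linarith
  have ht0 : 0 ≤ t := by linarith
  have hlpos : 0 < l ^ 2 := by positivity
  have hRhi0 : 0 < Rhi := lt_of_lt_of_le hlpos hRhi
  have hσS : σ ≤ S := by
    have : 3 / (4 * Rhi) ≤ 3 / (4 * l ^ 2) := div_le_div_of_nonneg_left (by norm_num) (by positivity) (by linarith)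
    linarith
  have htl2 : t ^ 2 ≤ l ^ 2 := pow_le_pow_left₀ ht0 htl 2
  have hE1a : t ^ 2 ≤ 1 + S / 2 := by linarith
  have hE1b : t ^ 2 ≤ Rhi := htl2.trans hRhi
  have hE1c : t ^ 2 ≤ 5 / 4 := htl2.trans hly
  have htT2 : t ^ 2 ≤ T2 := by rcases hT2 with h | h | h <;> linarith
  have htT : t ≤ T := (pow_le_pow_iff_left₀ ht0 hT0 two_ne_zero).mp (htT2.trans hT)
  have hllh : l ≤ lh := (pow_le_pow_iff_left₀ hl0 hlh0 two_ne_zero).mp (hRhi.trans hlh)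
  have hlL : l ^ 3 ≤ L :=
    calc l ^ 3 = l * l ^ 2 := by ring
      _ ≤ lh * Rhi := mul_le_mul hllh hRhi (by positivity) hlh0
      _ ≤ L := hL
  have hxX : x ≤ X := by linarith
  exact old_slot_two_core hRlo0 hRlo ht1 htT hl0 hlL hx0 hxX hX0 hX1 h2t hσS g01 g0T gX1 gXT

/-- **THE OLD CHAIN OF A DEEP SLOT, `k = 2`, WITH THE QUADRATIC CREDIT.**  In the census letters (`k = 2`: `R = ρ¹ = l²`), under `t ≤ l`, `l² ≤ 5∕4`,
`2(t²−1) ≤ σ`, `σ ≤ 1 − 3∕(4l²)`, `4x ≤ 3σ`:  `3l²t² + (3∕2)x·l⁴t − l³t³ − t³∕(1−x∕2) − 2(t²−1)(3t+t³)∕(2(1−x)) ≥ 0`.  Three intervals of `l²`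
(§4 `old_slot_two_case`). [folklore] -/
theorem old_slot_two_cert {l t x σ : ℝ}
    (ht1 : 1 ≤ t) (hl1 : 1 ≤ l) (htl : t ≤ l) (hly : l ^ 2 ≤ 5 / 4) (h2t : 2 * (t ^ 2 - 1) ≤ σ) (hσR : σ ≤ 1 - 3 / (4 * l ^ 2))
    (hx0 : 0 ≤ x) (hxa : 4 * x ≤ 3 * σ) :
    0 ≤ 3 * l ^ 2 * t ^ 2 + 3 / 2 * x * l ^ 4 * t - l ^ 3 * t ^ 3 - t ^ 3 / (1 - x / 2) - 2 * (t ^ 2 - 1) * (3 * t + t ^ 3) / (2 * (1 - x)) := by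
  have hR1 : 1 ≤ l ^ 2 := by nlinarith
  by_cases hc0 : l ^ 2 ≤ 9 / 8
  · exact old_slot_two_case ht1 hl1 htl hly h2t hσR hx0 hxa (by norm_num) hR1 hc0 (S := 1 / 3) (X := 1 / 4) (T2 := 9 / 8) (T := 1061 / 1000)
      (lh := 1061 / 1000) (L := 597 / 500) (by norm_num) (by norm_num) (by norm_num) (by norm_num) (Or.inr (Or.inl (by norm_num))) (by norm_num)
      (by norm_num) (by norm_num) (by norm_num) (by norm_num) (by norm_num) (by norm_num) (by norm_num) (by norm_num)
  by_cases hc1 : l ^ 2 ≤ 31 / 25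
  · exact old_slot_two_case ht1 hl1 htl hly h2t hσR hx0 hxa (by norm_num) (not_le.mp hc0).le hc1 (S := 49 / 124) (X := 147 / 496) (T2 := 297 / 248)
      (T := 219 / 200) (lh := 557 / 500) (L := 691 / 500) (by norm_num) (by norm_num) (by norm_num) (by norm_num) (Or.inl (by norm_num)) (by norm_num)
      (by norm_num) (by norm_num) (by norm_num) (by norm_num) (by norm_num) (by norm_num) (by norm_num) (by norm_num)
  exact old_slot_two_case ht1 hl1 htl hly h2t hσR hx0 hxa (by norm_num) (not_le.mp hc1).le hly (S := 2 / 5) (X := 3 / 10) (T2 := 6 / 5)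
    (T := 137 / 125) (lh := 1119 / 1000) (L := 1399 / 1000) (by norm_num) (by norm_num) (by norm_num) (by norm_num) (Or.inl (by norm_num)) (by norm_num)
    (by norm_num) (by norm_num) (by norm_num) (by norm_num) (by norm_num) (by norm_num) (by norm_num) (by norm_num)

end Summit.QuantumFields.BalabanUV.Beta.EriceRemainderEnclosureHistoryAutonomyComparisonAgeCompositionDecaySlotCertificate

end
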